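import Summits.Ventures.Crystal3D.Theorems.StickyWulffConstantNoReconstructionGainSlotRuleLocalSym
import Summits.Ventures.Crystal3D.Theorems.StickyWulffConstantNoReconstructionGainAxisBarlowFilm
import HarnessLib

/-!
# Single-family Barlow films with ONE overhanging registry slot: the per-ball count of the `A`-rule

HONEST FRAMING. Part of the venture `Summits/Ventures/Crystal3D` (cell `crystal3d-full`), helper
`--supports` the crux `NoReconstructionGain` (stmt-Ventures-19144, route
`route-Ventures-StickyWulffConstant`), line `adhesion`; local bookkeeping for the rung
`oneOverhangBarlowFilm_adhesion` (next file), built on `slotRule_T2'` (`…SlotRuleLocalSym`).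

Regime `C = 1`: exactly one hollow vector `τ_a` has `α + β_{τ_a} < 0` (its registry-up slot
`N + τ_a` points `ν`-DOWN into the substrate); `τ_b, τ_c` are the other two.  The **`A`-rule** is the
slot rule with cost-two polar slots

  `A = {N + τ_a, N − τ_b, −(N + τ_b), −(N + τ_c), −(N − τ_a), −(N − τ_c)}`

(one from each antipodal pair; NOT the sign pattern of any linear height, since it ranks `τ_b` over
`τ_c` on the twin slots while the in-plane slots keep the `ν`-order).  This file proves the abstract
per-ball statement `aRule_T2_core`: at most `1` partner in the two up-slots of `A` (they are `√(1/3)`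
apart) and at most `2` in its four down-slots (three `√(1/3)`-conflicts), hence — given that substrate
partners are `ν`-below and never at a `−A` slot — `#plug + Σ_film t ≤ 12 − deg` for every transfer of
`A`-rule type.  lead folder calc/slotrule.py: the `A`-rule certifies every `B`-film situation above a
half-space substrate at all 414 tested normals with `C = 1` (window included), either labelling of
`τ_b, τ_c`.

WHAT THIS IS NOT: the exclusion of substrate partners at `−A` slots (two one-step closure facts, done
in the rung); rung F-C1 not moved.
-/

noncomputable section

namespace Summit.Ventures.Crystal3D.Theorems

open Summit.Ventures.Crystal3D Finset
open scoped InnerProductSpace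

/-- **(T2) for the `A`-rule — abstract core.**  `X` a unit packing, `P ⊆ X`; the partners of `q`
lie on three lines `±e` (`e ∈ E3`, horizontal: `e₂ = 0`) or at polar slots `q ± N' ± τ`,
`τ ∈ {τ_a, τ_b, τ_c}` (`‖τ‖² = 1/3`, `Σ τ = 0`, `τ₂ = 0`, `N'₂ ≠ 0`); substrate partners are `ν`-below
and on a line or at an `A`-slot; `t` is a transfer of `A`-rule type at `q`.  Then (T2) holds at `q`. -/
theorem aRule_T2_core (X P : Finset (EuclideanSpace ℝ (Fin 3)))
    (hX : ∀ p ∈ X, ∀ q ∈ X, p ≠ q → 1 ≤ dist p q) (hPX : P ⊆ X)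
    (q ν N' τa τb τc : EuclideanSpace ℝ (Fin 3)) (E3 : List (EuclideanSpace ℝ (Fin 3)))
    (hE3 : E3.length ≤ 3) (hE2 : ∀ e ∈ E3, e 2 = 0)
    (hN2 : N' 2 ≠ 0) (hτ2 : τa 2 = 0 ∧ τb 2 = 0 ∧ τc 2 = 0)
    (hna : ‖τa‖ ^ 2 = 1 / 3) (hnb : ‖τb‖ ^ 2 = 1 / 3) (hnc : ‖τc‖ ^ 2 = 1 / 3)
    (hsum : τa + τb + τc = 0)
    (t : EuclideanSpace ℝ (Fin 3) → EuclideanSpace ℝ (Fin 3) → ℤ)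
    (ht_le : ∀ x, t x q ≤ 1)
    (ht_negA : ∀ x ∈ X \ P, dist q x = 1 →
      q - x ∈ ({N' + τa, N' - τb, -(N' + τb), -(N' + τc), -(N' - τa), -(N' - τc)} :
        Finset (EuclideanSpace ℝ (Fin 3))) →
      x - q ∉ ({N' + τa, N' - τb, -(N' + τb), -(N' + τc), -(N' - τa), -(N' - τc)} :
        Finset (EuclideanSpace ℝ (Fin 3))) → t x q ≤ -1)
    (ht_above : ∀ x ∈ X \ P, dist q x = 1 → (∃ e ∈ E3.toFinset, x - q = e ∨ x - q = -e) →
      0 < ⟪x - q, ν⟫_ℝ → t x q ≤ -1)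
    (ht_level : ∀ x ∈ X \ P, dist q x = 1 → (∃ e ∈ E3.toFinset, x - q = e ∨ x - q = -e) →
      ⟪x - q, ν⟫_ℝ = 0 → t x q ≤ 0)
    (hdir : ∀ x ∈ X, dist q x = 1 →
      (∃ e ∈ E3, x - q = e ∨ x - q = -e) ∨
      (∃ τ ∈ [τa, τb, τc], x - q = N' + τ ∨ x - q = N' - τ ∨ x - q = -(N' + τ) ∨ x - q = -(N' - τ)))
    (hplug : ∀ p ∈ P, dist q p = 1 → ⟪p - q, ν⟫_ℝ < 0 ∧
      ((∃ e ∈ E3, p - q = e ∨ p - q = -e) ∨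
        p - q ∈ ({N' + τa, N' - τb, -(N' + τb), -(N' + τc), -(N' - τa), -(N' - τc)} :
          Finset (EuclideanSpace ℝ (Fin 3))))) :
    ((P.filter fun p => dist q p = 1).card : ℤ)
        + ∑ x ∈ (X \ P).filter (fun x => dist q x = 1), t x q
      ≤ 12 - ((X.filter fun x => dist q x = 1).card : ℤ) := by
  classical
  set A : Finset (EuclideanSpace ℝ (Fin 3)) :=
    {N' + τa, N' - τb, -(N' + τb), -(N' + τc), -(N' - τa), -(N' - τc)} with hA
  set W : Finset (EuclideanSpace ℝ (Fin 3)) := E3.toFinset with hW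
  have hWcard : W.card ≤ 3 := (List.toFinset_card_le _).trans hE3
  -- in-plane vectors are not slots of `A` (third coordinates)
  have hA2 : ∀ a ∈ A, a 2 ≠ 0 := by
    intro a ha
    obtain ⟨h2a, h2b, h2c⟩ := hτ2
    simp only [hA, mem_insert, mem_singleton] at ha
    rcases ha with rfl | rfl | rfl | rfl | rfl | rfl <;>
      simp [h2a, h2b, h2c, hN2]
  have hWA : ∀ e ∈ W, e ∉ A ∧ -e ∉ A := by
    intro e he
    have he2 : e 2 = 0 := hE2 e (List.mem_toFinset.1 he)
    refine ⟨fun h => hA2 e h he2, fun h => hA2 (-e) h ?_⟩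
    simp [he2]
  -- sums of two hollow vectors and the four conflicts
  have h01 : τa + τb = -τc := by rw [← sub_eq_zero]; rw [← hsum]; abel
  have h02 : τa + τc = -τb := by rw [← sub_eq_zero]; rw [← hsum]; abel
  have h12 : τb + τc = -τa := by rw [← sub_eq_zero]; rw [← hsum]; abel
  have cU : ‖(N' + τa) - (N' - τb)‖ ^ 2 = 1 / 3 := by
    rw [show (N' + τa) - (N' - τb) = τa + τb by abel, h01, norm_neg, hnc]
  have c13 : ‖-(N' + τb) - -(N' - τa)‖ ^ 2 = 1 / 3 := by
    rw [show -(N' + τb) - -(N' - τa) = -(τa + τb) by abel, h01, neg_neg, hnc]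
  have c14 : ‖-(N' + τb) - -(N' - τc)‖ ^ 2 = 1 / 3 := by
    rw [show -(N' + τb) - -(N' - τc) = -(τb + τc) by abel, h12, neg_neg, hna]
  have c23 : ‖-(N' + τc) - -(N' - τa)‖ ^ 2 = 1 / 3 := by
    rw [show -(N' + τc) - -(N' - τa) = -(τa + τc) by abel, h02, neg_neg, hnb]
  have conflict : ∀ {a b : EuclideanSpace ℝ (Fin 3)}, ‖a - b‖ ^ 2 = 1 / 3 →
      q + a ∈ X → q + b ∈ X → False := by
    intro a b h ha hb
    exact not_both_mem_of_norm_sq hX (a := q + a) (b := q + b) (by rw [add_sub_add_left_eq_sub]; exact h) ha hb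
  have hxq : ∀ x d : EuclideanSpace ℝ (Fin 3), x - q = d → x = q + d := fun x d h => by rw [← h]; abel
  have occ : ∀ x d : EuclideanSpace ℝ (Fin 3), x ∈ X → x - q = d → q + d ∈ X :=
    fun x d hx h => by rw [← hxq x d h]; exact hx
  -- at most three partners at `A`-slots
  set NA := X.filter fun x => dist q x = 1 ∧ x - q ∈ A with hNA
  set Nup := NA.filter fun x => x - q = N' + τa ∨ x - q = N' - τb with hNup
  set Ndn := NA.filter fun x => x - q = -(N' + τb) ∨ x - q = -(N' + τc) ∨ x - q = -(N' - τa) ∨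
    x - q = -(N' - τc) with hNdn
  have memNA : ∀ x ∈ NA, x ∈ X := fun x hx => (mem_filter.1 hx).1
  have hsplit : NA.card ≤ Nup.card + Ndn.card := by
    have hsub : NA ⊆ Nup ∪ Ndn := by
      intro x hx
      have hxA := (mem_filter.1 hx).2.2
      simp only [hA, mem_insert, mem_singleton] at hxA
      rcases hxA with h | h | h | h | h | h
      · exact mem_union.2 (Or.inl (mem_filter.2 ⟨hx, Or.inl h⟩))
      · exact mem_union.2 (Or.inl (mem_filter.2 ⟨hx, Or.inr h⟩))
      · exact mem_union.2 (Or.inr (mem_filter.2 ⟨hx, Or.inl h⟩))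
      · exact mem_union.2 (Or.inr (mem_filter.2 ⟨hx, Or.inr (Or.inl h)⟩))
      · exact mem_union.2 (Or.inr (mem_filter.2 ⟨hx, Or.inr (Or.inr (Or.inl h))⟩))
      · exact mem_union.2 (Or.inr (mem_filter.2 ⟨hx, Or.inr (Or.inr (Or.inr h))⟩))
    exact (card_le_card hsub).trans (card_union_le _ _)
  have two : ∀ (S : Finset (EuclideanSpace ℝ (Fin 3))) (d₁ d₂ : EuclideanSpace ℝ (Fin 3)),
      (∀ x ∈ S, x - q = d₁ ∨ x - q = d₂) → S.card ≤ 2 := by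
    intro S d₁ d₂ h
    have hsub : S ⊆ {q + d₁, q + d₂} := by
      intro x hx
      rcases h x hx with e | e
      · rw [hxq x d₁ e]; simp
      · rw [hxq x d₂ e]; simp
    exact (card_le_card hsub).trans (card_insert_le _ _ |>.trans (by simp))
  have one : ∀ (S : Finset (EuclideanSpace ℝ (Fin 3))) (d₁ : EuclideanSpace ℝ (Fin 3)),
      (∀ x ∈ S, x - q = d₁) → S.card ≤ 1 := by
    intro S d₁ h
    have hsub : S ⊆ {q + d₁} := by
      intro x hx; rw [hxq x d₁ (h x hx)]; simp
    exact (card_le_card hsub).trans (by simp)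
  have hup : Nup.card ≤ 1 := by
    by_cases h1 : q + (N' + τa) ∈ X
    · refine one Nup (N' + τa) fun x hx => ?_
      obtain ⟨hxD, h⟩ := mem_filter.1 hx
      rcases h with h | h
      · exact h
      · exact (conflict cU h1 (occ x _ (memNA x hxD) h)).elim
    · refine one Nup (N' - τb) fun x hx => ?_
      obtain ⟨hxD, h⟩ := mem_filter.1 hx
      rcases h with h | h
      · exact (h1 (occ x _ (memNA x hxD) h)).elim
      · exact h
  have hdn : Ndn.card ≤ 2 := by
    by_cases ha : q + -(N' + τb) ∈ X
    · refine two Ndn (-(N' + τb)) (-(N' + τc)) fun x hx => ?_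
      obtain ⟨hxD, h⟩ := mem_filter.1 hx
      rcases h with h | h | h | h
      · exact Or.inl h
      · exact Or.inr h
      · exact (conflict c13 ha (occ x _ (memNA x hxD) h)).elim
      · exact (conflict c14 ha (occ x _ (memNA x hxD) h)).elim
    · by_cases hc : q + -(N' - τa) ∈ X
      · refine two Ndn (-(N' - τa)) (-(N' - τc)) fun x hx => ?_
        obtain ⟨hxD, h⟩ := mem_filter.1 hx
        rcases h with h | h | h | h
        · exact (ha (occ x _ (memNA x hxD) h)).elim
        · exact (conflict c23 (occ x _ (memNA x hxD) h) hc).elim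
        · exact Or.inl h
        · exact Or.inr h
      · refine two Ndn (-(N' + τc)) (-(N' - τc)) fun x hx => ?_
        obtain ⟨hxD, h⟩ := mem_filter.1 hx
        rcases h with h | h | h | h
        · exact (ha (occ x _ (memNA x hxD) h)).elim
        · exact Or.inl h
        · exact (hc (occ x _ (memNA x hxD) h)).elim
        · exact Or.inr h
  have hA3 : NA.card ≤ 3 := by omega
  -- the classification in `A ∪ −A ∪ lines` form
  have hdir' : ∀ x ∈ X, dist q x = 1 → (∃ e ∈ W, x - q = e ∨ x - q = -e) ∨ x - q ∈ A ∨ q - x ∈ A := by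
    intro x hx hd
    rcases hdir x hx hd with ⟨e, he, hxe⟩ | ⟨τ, hτ, hτx⟩
    · exact Or.inl ⟨e, List.mem_toFinset.2 he, hxe⟩
    · right
      have hqx : q - x = -(x - q) := by abel
      simp only [List.mem_cons, List.mem_nil_iff, or_false] at hτ
      rcases hτ with rfl | rfl | rfl <;> rcases hτx with h | h | h | h
      -- τa: N+τa ∈ A; N-τa : -(N-τa) ∈ A so q-x ∈ A; -(N+τa): q - x = N+τa ∈ A; -(N-τa) ∈ A
      · exact Or.inl (by rw [h, hA]; simp)
      · exact Or.inr (by rw [hqx, h, hA]; simp)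
      · exact Or.inr (by rw [hqx, h, neg_neg, hA]; simp)
      · exact Or.inl (by rw [h, hA]; simp)
      -- τb: N+τb: q-x = -(N+τb) ∈ A; N-τb ∈ A; -(N+τb) ∈ A; -(N-τb): q - x = N - τb ∈ A
      · exact Or.inr (by rw [hqx, h, hA]; simp)
      · exact Or.inl (by rw [h, hA]; simp)
      · exact Or.inl (by rw [h, hA]; simp)
      · exact Or.inr (by rw [hqx, h, neg_neg, hA]; simp)
      -- τc: N+τc: q-x = -(N+τc) ∈ A; N-τc: q - x = -(N-τc) ∈ A; -(N+τc) ∈ A; -(N-τc) ∈ A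
      · exact Or.inr (by rw [hqx, h, hA]; simp)
      · exact Or.inr (by rw [hqx, h, hA]; simp)
      · exact Or.inl (by rw [h, hA]; simp)
      · exact Or.inl (by rw [h, hA]; simp)
  have hplug' : ∀ p ∈ P, dist q p = 1 → ⟪p - q, ν⟫_ℝ < 0 ∧ ((∃ e ∈ W, p - q = e ∨ p - q = -e) ∨ p - q ∈ A) := by
    intro p hp hd
    obtain ⟨hneg, hcl⟩ := hplug p hp hd
    refine ⟨hneg, ?_⟩
    rcases hcl with ⟨e, he, hpe⟩ | hA'
    · exact Or.inl ⟨e, List.mem_toFinset.2 he, hpe⟩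
    · exact Or.inr hA'
  exact slotRule_T2' X P hPX q ν A W t hWcard hWA hdir' hplug' hA3 ht_le ht_negA ht_above ht_level

end Summit.Ventures.Crystal3D.Theorems

end
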